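import Summits.QuantumFields.BalabanUV.T4Continuum.Support.InsertionChannelEnd

/-!
# OutputRateChannelReach — which rates `θ′ < 1` the channel-reading road of row NE5 reaches: the route's EXACT smallness of the
# one-run envelope `G` against `L` at the printed-count letters (`G < (1 − L⁻¹)(1 − ρ₀)∕(6L)⁴`), and its gain-parametric twin
# (cell `pub-balaban`, T⁴ fan-out, `HOME/BINDER-OWNERS.md` row NE5, owner lineage t4-ne5-p1, gen 32; follower of the O1-c holder's
# `Support/InsertionChannelEnd` (leaf-06-g2; owner ruling R35, journal l.12779) and of the owner's `Support/OutputRateCount124` (R30 (iii)))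

HONEST FRAMING (T4-DAG PAGE 1).  Rung (B)+1 on ONE finite four-torus of fixed physical size — NOT infinite volume, NOT a mass gap, NOT
the Clay problem; `FlowStep.BetaPertH`, (B), (B^μ) do not occur here.  NE5 (`T4OutputRate.NE5`) is NOT PRINTED ([Balaban1987RG1]–
[Balaban1989LargeFieldII] print ε-UNIFORM bounds, never η-RATES; cell GAPS G-t4-U3-1) and NOT PROVED; NE9 is NOT PRINTED and NOT PROVED
(spine 0/9).  Nothing of Bałaban's series is asserted; 0 cite tags; the END faces conclude `∃ θ′ < 1, ∃ C₅, T4OutputRate.NE5 EA EB W κ θ′ C₅`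
with every analytic input DISPLAYED.  HONEST DEPENDENCY (cell, verbatim): continuum YM on T⁴ ⇐ BetaPertH ∧ nine spine estimates (0/9
proved); BetaPertH ⇐ (D1) ∧ (D4) ∧ CAP+tail; G-an2-4 gates asym, D1 and NE2/3/4.

WHY.  On the channel-reading road (`InsertionChannelEnd.ne5_at_of_stepModel_fibre_pieceChannel_nat`: W3 + `InsAffine`∕`InsBlind` of row NE5
READ from row NE9's S5, letters `c = (6L)⁴`, `ω = L⁻¹`) the route's sharp smallness S is the explicit inequality `G < (θ′ − L⁻¹)(1 − ρ₀)∕(6L)⁴`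
in the TARGET rate `θ′` (`OutputRateCount124.smallnessG_count124_iff`).  The census question «for which one-run envelopes `G` does the
road conclude ANY rate `θ′ < 1`?» therefore has an exact answer, typed here: iff `G < (1 − L⁻¹)(1 − ρ₀)∕(6L)⁴`, and then for EVERY input
rate `θ < 1` of W1∕W4 (take `θ′` strictly between `max θ (L⁻¹ + G∕(1 − ρ₀)·(6L)⁴)` and `1`).  [analysis, not kernel]: with `G ~ O(1)C₃ε₁` per
history margin (the (1.36)-slack) this reads «O(1)·C₃·ε₁·(6L)⁴ < (1 − L⁻¹)(1 − ρ₀)·slack» — an ε₁-AFTER-L smallness of [II]'s ORDER of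
constants (ε₁ chosen after L, M, κ₁), NOT a printed assumption ([II] p. 21 assumes only O(1)C₃ε₁ ≤ ½E₀); STILL SYMBOLIC (no numeric instance).

WHAT THIS MODULE IS (bookkeeping/[folklore]):
* §1 `exists_rate_lt_one_iff` — `(∃ θ′ < 1, G < (θ′ − L⁻¹)(1 − ρ₀)∕(6L)⁴) ↔ G < (1 − L⁻¹)(1 − ρ₀)∕(6L)⁴` (`1 < L`, `ρ₀ < 1`);
  `exists_rate_lt_one_iff_profile` — the gain-parametric twin `(∃ θ′ < 1, ω + Λ·cQ < θ′) ↔ ω + Λ·cQ < 1`.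
* §2 `exists_rate_lt_one_of_stepModel_fibre_pieceChannel_nat` — the binders of `InsertionChannelEnd.ne5_at_of_stepModel_fibre_pieceChannel_nat`
  with `θ ≤ θ′ ≤ 1` and the smallness in `θ′` REPLACED by `θ < 1` and `G < (1 − L⁻¹)(1 − ρ₀)∕(6L)⁴` ⟹ `∃ θ′ < 1, ∃ C₅, NE5 EA EB W κ θ′ C₅`;
  `exists_rate_lt_one_of_stepModel_fibre_pieceChannelG_nat` — the same for the gain-parametric piece form (`ω + G∕(1 − ρ₀)·cQ < 1`).
STATUS (census, Edison rule).  Discharges NO wall; makes leaf L11 (S) of `SKELETON-NE5-P1` EXACT on the channel-reading road: the set of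
reachable target rates is the open interval above `max θ (L⁻¹ + G∕(1 − ρ₀)·(6L)⁴)`, non-empty below `1` iff the displayed inequality holds.
NE5 NOT PROVED; NE9 NOT PROVED; 0/12 leaves instantiated on Bałaban's concrete objects (the O1 instance is the substrate cell's, T4-DAG
Q-NE9-O1); spine 0/9.  0 sorry; axioms ⊆ {propext, Classical.choice, Quot.sound}.
-/

noncomputable section

namespace Summit.QuantumFields.BalabanUV.T4Continuum.OutputRateChannelReach

open Literature.MathematicalPhysics.QuantumFieldTheory.Balaban1983to89
open Literature.MathematicalPhysics.QuantumFieldTheory.Balaban1983to89.T4OutputRate (Carriers Functional DecayBound NE5)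
open Literature.MathematicalPhysics.QuantumFieldTheory.Balaban1983to89.T4InputCauchyRateData (StepModel)
open Summit.QuantumFields.BalabanUV.T4Continuum.B13HistDatum (HistFrame Hist)
open Summit.QuantumFields.BalabanUV.T4Continuum.NE9Lemma1Counting (PieceData pieceChannel SrcScale PieceBound LevelCounts weightOf
  ellPrinted)
open Summit.QuantumFields.BalabanUV.T4Continuum.NE9Lemma1Gain (PieceBoundG LevelCountsG agePow)
open Summit.QuantumFields.BalabanUV.T4Continuum.OutputRateCount124 (smallnessG_count124_iff)
open Summit.QuantumFields.BalabanUV.T4Continuum.InsertionChannelReading (ReadsChannel)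
open Summit.QuantumFields.BalabanUV.T4Continuum.InsertionChannelEnd

/-! ## §1 The exact smallness: which envelopes `G` leave a target rate below `1` -/

section Arithmetic

/-- **THE ROUTE'S SMALLNESS OF `G` AGAINST `L`, EXACTLY.**  At the printed-count letters `c = (6L)⁴`, `ω = L⁻¹` a target rate `θ′ < 1` obeying
the explicit smallness EXISTS iff `G < (1 − L⁻¹)(1 − ρ₀)∕(6L)⁴` (equivalently `L⁻¹ + G∕(1 − ρ₀)·(6L)⁴ < 1`; `exists_between` through
`smallnessG_count124_iff`). [folklore] -/
theorem exists_rate_lt_one_iff {L G ρ₀ : ℝ} (hL : 1 < L) (hρ₀ : ρ₀ < 1) :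
    (∃ θ' : ℝ, θ' < 1 ∧ G < (θ' - L⁻¹) * (1 - ρ₀) / (6 * L) ^ 4) ↔ G < (1 - L⁻¹) * (1 - ρ₀) / (6 * L) ^ 4 := by
  have hL0 : 0 < L := by linarith
  simp only [← smallnessG_count124_iff hL0 hρ₀]
  constructor
  · rintro ⟨θ', hθ'1, h⟩
    exact h.trans hθ'1
  · intro h
    obtain ⟨θ', h1, h2⟩ := exists_between h
    exact ⟨θ', h2, h1⟩

/-- The gain-parametric twin (letters `cQ`, `ω`, Cauchy modulus `Λ`): a target rate `θ′ < 1` with `ω + Λ·cQ < θ′` exists iff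
`ω + Λ·cQ < 1`. [folklore] -/
theorem exists_rate_lt_one_iff_profile {ω Λ cQ : ℝ} : (∃ θ' : ℝ, θ' < 1 ∧ ω + Λ * cQ < θ') ↔ ω + Λ * cQ < 1 :=
  ⟨fun ⟨_, hθ'1, h⟩ => h.trans hθ'1, fun h => let ⟨θ', h1, h2⟩ := exists_between h; ⟨θ', h2, h1⟩⟩

end Arithmetic

/-! ## §2 END faces: some rate `θ′ < 1` for every input rate `θ < 1` -/

section EndPiece

variable {C : Carriers} {Bg ι : Type} {Op : Type*} [NormedAddCommGroup Op] [NormedSpace ℂ Op] {F : HistFrame C}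
  {M : StepModel C Op (Hist F)} {out : F.Idx → ι} {W : Set (ℕ → ℝ)} {α β γ : Type} {P : PieceData C Bg ι α β γ}

/-- **NE5 AT SOME RATE `θ′ < 1` ON THE PIECE-CHANNEL ROAD (printed-count letters)** for EVERY input rate `θ < 1` of W1∕W4, as soon as the
one-run envelope obeys `G < (1 − L⁻¹)(1 − ρ₀)∕(6L)⁴`: `θ′` strictly between `max θ (L⁻¹ + G∕(1 − ρ₀)·(6L)⁴)` and `1`, fed into
`InsertionChannelEnd.ne5_at_of_stepModel_fibre_pieceChannel_nat` BY NAME.  All other binders verbatim. [folklore] -/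
theorem exists_rate_lt_one_of_stepModel_fibre_pieceChannel_nat {EA : Functional C C.BgA} {EB : Functional C C.BgB}
    {L κ κ₁ d0 O1 G EA₀ E₀ δ δ' θ ρ₀ B : ℝ} {k₀ : ℕ} {Kp : ℕ → ι → ℝ} (hL : 1 < L)
    (hrA : M.RepresentsA EA W) (hrB : M.RepresentsB EB W) (hbase : M.InBase EB W) (hopF : M.OpFibreEnvelope W κ G)
    (hhistF : M.HistFibreEnvelope W κ G) (hdA : DecayBound EA W EA₀ κ) (hdB : DecayBound EB W E₀ κ) (hop : M.OperatorRate W δ θ)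
    (hins : M.InsertionRate W κ E₀ δ' θ) (hR : ReadsChannel M (pieceChannel P) out W) (hsrc : SrcScale P)
    (hPiece : PieceBound P κ κ₁ d0 Kp (ellPrinted L)) (hLev : LevelCounts P κ κ₁ O1 L (ellPrinted L))
    (hKp : ∀ k y, 0 ≤ Kp k y) (hO1 : 0 ≤ O1) (hwt : ∀ k i, weightOf P κ₁ d0 O1 Kp k (out i) ≤ M.rHist (k + 1) * F.wt i)
    (hG : 0 ≤ G) (hδ : 0 ≤ δ + δ') (hθ : 0 ≤ θ) (hθ1 : θ < 1) (hρ₀ : ρ₀ < 1)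
    (hnear : (δ + δ') * θ ^ k₀ + (6 * L) ^ 4 * (EA₀ + E₀) / (1 - L⁻¹) ≤ ρ₀) (hB : 0 ≤ B)
    (hfirst : ∀ k < k₀, EA₀ + E₀ ≤ B * θ ^ k) (hsmall : G < (1 - L⁻¹) * (1 - ρ₀) / (6 * L) ^ 4) :
    ∃ θ' : ℝ, θ' < 1 ∧ ∃ C₅ : ℝ, NE5 EA EB W κ θ' C₅ := by
  have hL0 : 0 < L := by linarith
  have hX : L⁻¹ + G / (1 - ρ₀) * (6 * L) ^ 4 < 1 := (smallnessG_count124_iff hL0 hρ₀).2 hsmall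
  obtain ⟨θ', h1, h2⟩ := exists_between (max_lt hθ1 hX)
  exact ⟨θ', h2, _, ne5_at_of_stepModel_fibre_pieceChannel_nat hL hrA hrB hbase hopF hhistF hdA hdB hop hins hR hsrc hPiece hLev hKp
    hO1 hwt hG hδ hθ (le_of_max_le_left h1.le) h2.le hρ₀ hnear hB hfirst
    ((smallnessG_count124_iff hL0 hρ₀).1 (lt_of_le_of_lt (le_max_right _ _) h1))⟩

/-- **NE5 AT SOME RATE `θ′ < 1` ON THE GAIN-PARAMETRIC PIECE ROAD** (letters `cQ`, `ω > 0`; row NE9's kernel currency of record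
`PieceBoundG` + `LevelCountsG … (agePow ω)`) for every input rate `θ < 1`, as soon as `ω + G∕(1 − ρ₀)·cQ < 1`: fed into
`InsertionChannelEnd.ne5_at_of_stepModel_fibre_pieceChannelG_nat` BY NAME. [folklore] -/
theorem exists_rate_lt_one_of_stepModel_fibre_pieceChannelG_nat {EA : Functional C C.BgA} {EB : Functional C C.BgB}
    {κ κ₁ d0 O1 cQ ω G EA₀ E₀ δ δ' θ ρ₀ B : ℝ} {k₀ : ℕ} {Kp : ℕ → ι → ℝ} {gain : ℕ → ℕ → ℝ}
    (hrA : M.RepresentsA EA W) (hrB : M.RepresentsB EB W) (hbase : M.InBase EB W) (hopF : M.OpFibreEnvelope W κ G)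
    (hhistF : M.HistFibreEnvelope W κ G) (hdA : DecayBound EA W EA₀ κ) (hdB : DecayBound EB W E₀ κ) (hop : M.OperatorRate W δ θ)
    (hins : M.InsertionRate W κ E₀ δ' θ) (hR : ReadsChannel M (pieceChannel P) out W) (hsrc : SrcScale P)
    (hPiece : PieceBoundG P κ κ₁ d0 Kp gain) (hLev : LevelCountsG P κ κ₁ O1 cQ gain (agePow ω)) (hKp : ∀ k y, 0 ≤ Kp k y)
    (hO1 : 0 ≤ O1) (hgain : ∀ k j, 0 ≤ gain k j) (hwt : ∀ k i, weightOf P κ₁ d0 O1 Kp k (out i) ≤ M.rHist (k + 1) * F.wt i)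
    (hG : 0 ≤ G) (hδ : 0 ≤ δ + δ') (hθ : 0 ≤ θ) (hθ1 : θ < 1) (hcQ : 0 ≤ cQ) (hω : 0 < ω) (hρ₀ : ρ₀ < 1)
    (hnear : (δ + δ') * θ ^ k₀ + cQ * (EA₀ + E₀) / (1 - ω) ≤ ρ₀) (hB : 0 ≤ B) (hfirst : ∀ k < k₀, EA₀ + E₀ ≤ B * θ ^ k)
    (hsmall : ω + G / (1 - ρ₀) * cQ < 1) :
    ∃ θ' : ℝ, θ' < 1 ∧ ∃ C₅ : ℝ, NE5 EA EB W κ θ' C₅ := by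
  obtain ⟨θ', h1, h2⟩ := exists_between (max_lt hθ1 hsmall)
  exact ⟨θ', h2, _, ne5_at_of_stepModel_fibre_pieceChannelG_nat hrA hrB hbase hopF hhistF hdA hdB hop hins hR hsrc hPiece hLev hKp
    hO1 hgain hwt hG hδ hθ (le_of_max_le_left h1.le) h2.le hcQ hω hρ₀ hnear hB hfirst (lt_of_le_of_lt (le_max_right _ _) h1)⟩

end EndPiece

end Summit.QuantumFields.BalabanUV.T4Continuum.OutputRateChannelReach

end
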